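import Literature.Barriers.Parity.SiegelZeroPrimePairsCnSum
import Literature.NumberTheory.LFunctions.SiegelZeroLacunaryDivisorSums
import HarnessLib

/-!
# Matomäki–Merikoski (7.1), the `c_n`-part of the error, under the exceptional zero

Sibling of `Literature/Barriers/Parity/SiegelZeroPrimePairsCnSum.lean`.  Everything in this file is
PROVED.  In the first display of §7 of Matomäki–Merikoski (IMRN 2023; arXiv:2112.11412, p. 20),
`∑_n g(n/X)Λ(n)Λ(±n+h) = ∑_{(n(±n+h), qP(z)) = 1} g(n/X) λ'(n)λ'(±n+h) + O(…)`, the error collects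
(2.5)/(2.6), Lemma 2.1 and Lemma 2.2.  In the tree's rendering of (2.6)
(`MatomakiMerikoski2023_eq26`: error `log(2X+h) ∑_{adm} (τ(n) c_{n+h} + c_n)`, `c_n = λ'(n) − Λ(n) ≥ 0`)
the error has two halves; this file bounds the **`c_n`-half** completely under the hypotheses of
Theorem 1.3: for a primitive quadratic `χ (mod q)` with `L(1 − 1/(η log q), χ) = 0`, `η ≥ 10`,
`z = q^v ≥ 2`, `z < X`, `u := log X/log z ≤ z − 1` and the normalisation
`B' + 1/z ≤ 1`, `B' := 1/(v²η^{v/2}) + (v/η) u`,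

  `∑_{n ≤ X adm} (λ'(n) − Λ(n)) ≤ K (h/φ(h)) X (log X/log² z) (B' + u²/z)`

(`MatomakiMerikoski.sum_adm_charLog_sub_vonMangoldt_le_of_exceptionalZero`), "adm" meaning that all
prime factors of `n` and of `n + h` are `≥ z` and prime to `q`.  This is the pair-sieve bound of the
sibling file (`sum_adm_charLog_sub_vonMangoldt_le`, `≤ C (h/φ(h)) X (log X/log² z) ∑_{z ≤ d ≤ X rough} λ(d)(d/φ(d))/d`)
combined with the sharp form of Lemma 2.2 (`SiegelZero.MatomakiMerikoski2023_lemma22_sharp`,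
`∑_{z ≤ d ≤ X rough} λ(d)/d ≤ K (B' + u²/z)`), after removing the factor `d/φ(d) ≤ e` (a `z`-rough
`d ≤ X` has at most `u` prime factors, each `≥ z`, so `d/φ(d) ≤ exp(u/(z−1)) ≤ e`).  Multiplied by the
outer `log(2X+h)` of (2.6) it is the contribution `≪ (h/φ(h)) X u² (B' + u²/z)` to (7.1), within the
printed `O((h/φ(h)) X (u⁸/(V²η^{V/(3u)}) + u⁶V/η + u^{10}/q^{V/(2u)}))`.  The other half
(`τ(n) c_{n+h}`, the divisor-weighted part of Lemma 2.1) is NOT treated here.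

## References

* K. Matomäki, J. Merikoski, IMRN 2023:23, 20337–20384 (arXiv:2112.11412), §7 first display (7.1),
  Lemma 2.1 (first case of the proof) and Lemma 2.2. [cite: MatomakiMerikoski2023, §7 (7.1) and Lemmas 2.1–2.2]
-/

noncomputable section

open Finset Real
open scoped ArithmeticFunction.vonMangoldt

namespace Literature.Barriers.Parity.MatomakiMerikoski

open Literature.Barriers.Parity.TaoTeravainen
open Literature.NumberTheory.LFunctions.RealChar (charDivisorSum charDivisorSum_nonneg
  ofReal_charDivisorSum)
open Literature.NumberTheory.LFunctions.SiegelZero (MatomakiMerikoski2023_lemma22_sharp)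
open Literature.NumberTheory.Sieve (primesProdBelow coprime_primesProdBelow_iff)

/-! ### `d/φ(d)` for rough `d` -/

/-- A natural number all of whose prime factors are `≥ z > 1` has at most `log d/log z` of them.
[folklore] -/
private theorem card_primeFactors_le_log_div {d : ℕ} (hd : d ≠ 0) {z : ℝ} (hz : 1 < z)
    (hr : ∀ p ∈ d.primeFactors, z ≤ (p : ℝ)) :
    (d.primeFactors.card : ℝ) ≤ Real.log d / Real.log z := by
  have hz0 : 0 < z := by linarith
  have h1 : z ^ d.primeFactors.card ≤ ∏ p ∈ d.primeFactors, (p : ℝ) := by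
    rw [← Finset.prod_const]
    exact Finset.prod_le_prod (fun _ _ => hz0.le) fun p hp => hr p hp
  have h2 : ∏ p ∈ d.primeFactors, (p : ℝ) ≤ d := by
    have h3 : ∏ p ∈ d.primeFactors, p ≤ d :=
      Nat.le_of_dvd (Nat.pos_of_ne_zero hd) (Nat.prod_primeFactors_dvd d)
    have h4 : ((∏ p ∈ d.primeFactors, p : ℕ) : ℝ) ≤ d := by exact_mod_cast h3
    rwa [Nat.cast_prod] at h4
  have h5 := Real.log_le_log (by positivity) (h1.trans h2)
  rw [Real.log_pow] at h5
  rw [le_div_iff₀ (Real.log_pos hz)]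
  exact h5

/-- `d/φ(d) = ∏_{p ∣ d} p/(p − 1) ≤ exp(ω(d)/(z − 1))` when every prime factor of `d ≠ 0` is `≥ z > 1`.
[folklore] -/
theorem self_div_totient_le_exp_of_rough {d : ℕ} (hd : d ≠ 0) {z : ℝ} (hz : 1 < z)
    (hr : ∀ p ∈ d.primeFactors, z ≤ (p : ℝ)) :
    (d : ℝ) / Nat.totient d ≤ Real.exp (d.primeFactors.card / (z - 1)) := by
  have hφ0 : (0 : ℝ) < Nat.totient d := by exact_mod_cast Nat.totient_pos.mpr (Nat.pos_of_ne_zero hd)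
  -- `φ(d) ∏ p = d ∏ (p - 1)`
  have hid := Nat.totient_mul_prod_primeFactors d
  have hid' : (Nat.totient d : ℝ) * ∏ p ∈ d.primeFactors, (p : ℝ) =
      (d : ℝ) * ∏ p ∈ d.primeFactors, ((p : ℝ) - 1) := by
    have h1 : ((Nat.totient d * ∏ p ∈ d.primeFactors, p : ℕ) : ℝ) =
        ((d * ∏ p ∈ d.primeFactors, (p - 1) : ℕ) : ℝ) := by exact_mod_cast hid
    push_cast at h1
    rw [h1]
    congr 1
    refine Finset.prod_congr rfl fun p hp => ?_
    rw [Nat.cast_sub (Nat.prime_of_mem_primeFactors hp).one_le, Nat.cast_one]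
  have hP1 : 0 < ∏ p ∈ d.primeFactors, ((p : ℝ) - 1) :=
    Finset.prod_pos fun p hp => by
      have := (Nat.prime_of_mem_primeFactors hp).two_le
      have : (2 : ℝ) ≤ p := by exact_mod_cast this
      linarith
  -- `d/φ(d) = ∏ p/(p-1)`
  have heq : (d : ℝ) / Nat.totient d = ∏ p ∈ d.primeFactors, ((p : ℝ) / ((p : ℝ) - 1)) := by
    rw [Finset.prod_div_distrib, div_eq_div_iff hφ0.ne' hP1.ne']
    linarith [hid']
  rw [heq]
  -- each factor `p/(p-1) = 1 + 1/(p-1) ≤ exp(1/(p-1)) ≤ exp(1/(z-1))`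
  have hz1 : 0 < z - 1 := by linarith
  calc ∏ p ∈ d.primeFactors, ((p : ℝ) / ((p : ℝ) - 1))
      ≤ ∏ p ∈ d.primeFactors, Real.exp (1 / (z - 1)) := by
        refine Finset.prod_le_prod (fun p hp => ?_) fun p hp => ?_
        · have := (Nat.prime_of_mem_primeFactors hp).two_le
          have : (2 : ℝ) ≤ p := by exact_mod_cast this
          exact div_nonneg (by linarith) (by linarith)
        · have hzp := hr p hp
          have hp1 : 0 < (p : ℝ) - 1 := by linarith
          have e1 : (p : ℝ) / ((p : ℝ) - 1) = 1 + 1 / ((p : ℝ) - 1) := by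
            field_simp
            ring
          rw [e1]
          calc 1 + 1 / ((p : ℝ) - 1) ≤ 1 + 1 / (z - 1) := by
                gcongr
            _ ≤ Real.exp (1 / (z - 1)) := by
                have := Real.add_one_le_exp (1 / (z - 1))
                linarith
    _ = Real.exp (d.primeFactors.card / (z - 1)) := by
        rw [Finset.prod_const, ← Real.exp_nat_mul]
        congr 1
        ring

/-- For `z > 1`, `d ≠ 0` `z`-rough with `d ≤ X` and `log X/log z ≤ z − 1`: `d/φ(d) ≤ e`. [folklore] -/
theorem self_div_totient_le_exp_one_of_rough {d X : ℕ} (hd : d ≠ 0) (hdX : d ≤ X) {z : ℝ} (hz : 1 < z)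
    (hr : ∀ p ∈ d.primeFactors, z ≤ (p : ℝ)) (huz : Real.log X / Real.log z ≤ z - 1) :
    (d : ℝ) / Nat.totient d ≤ Real.exp 1 := by
  refine (self_div_totient_le_exp_of_rough hd hz hr).trans (Real.exp_le_exp.mpr ?_)
  have hz1 : 0 < z - 1 := by linarith
  have hlogz : 0 < Real.log z := Real.log_pos hz
  have h1 := card_primeFactors_le_log_div hd hz hr
  have hd1 : (1 : ℝ) ≤ d := by exact_mod_cast Nat.one_le_iff_ne_zero.mpr hd
  have h2 : Real.log d / Real.log z ≤ Real.log X / Real.log z :=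
    div_le_div_of_nonneg_right (Real.log_le_log (by linarith) (by exact_mod_cast hdX)) hlogz.le
  rw [div_le_one hz1]
  linarith

/-! ### The bridge between the two renderings of `λ = 1 ∗ χ` and of `z`-roughness -/

/-- `oneConvChi χ = charDivisorSum χ` (both are `n ↦ Re ∑_{d ∣ n} χ(d)`) for quadratic `χ`. [folklore] -/
theorem oneConvChi_eq_charDivisorSum {N : ℕ} [NeZero N] (χ : DirichletCharacter ℂ N) (hχ : χ ^ 2 = 1)
    (n : ℕ) : oneConvChi χ n = charDivisorSum χ n := by
  rw [oneConvChi_eq_re_zetaMul χ n, ← ofReal_charDivisorSum χ hχ n, Complex.ofReal_re]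

/-- All prime factors `≥ z` implies coprimality with `P(z) = ∏_{p < z} p`. [folklore] -/
theorem coprime_primesProdBelow_of_rough {d : ℕ} (hd : d ≠ 0) {z : ℝ}
    (hr : ∀ p ∈ d.primeFactors, z ≤ (p : ℝ)) : d.Coprime (primesProdBelow z) := by
  rw [coprime_primesProdBelow_iff]
  intro p hp hpd
  rw [Nat.mem_primesBelow] at hp
  have h1 := hr p (Nat.mem_primeFactors.mpr ⟨hp.2, hpd, hd⟩)
  have h2 : (p : ℝ) < z := Nat.lt_ceil.mp hp.1
  linarith

/-! ### The `c_n`-half of (7.1) -/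

/-- **The `c_n`-part of the error in (7.1) of Matomäki–Merikoski, under the exceptional zero.**  There is
an absolute `K > 0` such that for every primitive quadratic `χ (mod q)`, every `η ≥ 10` with
`L(1 − 1/(η log q), χ) = 0`, every `v > 0`, writing `z = q^v`, and all naturals `X, h` with `1 ≤ h`,
`2 ≤ z < X`, `log X/log z ≤ z − 1` and `1/(v²η^{v/2}) + (v/η)(log X/log z) + 1/z ≤ 1`:
`∑_{1 ≤ n ≤ X, adm} (λ'(n) − Λ(n)) ≤ K (h/φ(h)) X (log X/log² z) (1/(v²η^{v/2}) + (v/η)(log X/log z) + (1/z)(log X/log z)²)`,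
"adm" = every prime factor of `n` and of `n + h` is `≥ z` and does not divide `q`; `λ' = χ ∗ log`
(`TaoTeravainen.charLog`).  (The pair-sieve bound of the sibling file combined with the sharp Lemma 2.2.)
[cite: MatomakiMerikoski2023, §7 (7.1), Lemma 2.1 (proof, first case) and Lemma 2.2] -/
theorem sum_adm_charLog_sub_vonMangoldt_le_of_exceptionalZero :
    ∃ K : ℝ, 0 < K ∧ ∀ (q : ℕ) [NeZero q] (χ : DirichletCharacter ℂ q), χ.IsPrimitive → χ.IsQuadratic →
      ∀ η : ℝ, 10 ≤ η → χ.LFunction ((1 - 1 / (η * Real.log q) : ℝ) : ℂ) = 0 →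
      ∀ v : ℝ, 0 < v → ∀ (X h : ℕ), 1 ≤ h → 2 ≤ (q : ℝ) ^ v → (q : ℝ) ^ v < X →
        Real.log X / Real.log ((q : ℝ) ^ v) ≤ (q : ℝ) ^ v - 1 →
        1 / (v ^ 2 * η ^ (v / 2)) + v / η * (Real.log X / Real.log ((q : ℝ) ^ v)) + 1 / (q : ℝ) ^ v ≤ 1 →
        ∑ n ∈ (Icc 1 X).filter (fun n : ℕ =>
            (∀ p ∈ n.primeFactors, (q : ℝ) ^ v ≤ (p : ℝ) ∧ ¬ p ∣ q) ∧
              (∀ p ∈ (n + h).primeFactors, (q : ℝ) ^ v ≤ (p : ℝ) ∧ ¬ p ∣ q)),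
            (charLog χ n - Λ n) ≤
          K * ((h : ℝ) / Nat.totient h) * X * (Real.log X / Real.log ((q : ℝ) ^ v) ^ 2) *
            (1 / (v ^ 2 * η ^ (v / 2)) + v / η * (Real.log X / Real.log ((q : ℝ) ^ v)) +
              1 / (q : ℝ) ^ v * (Real.log X / Real.log ((q : ℝ) ^ v)) ^ 2) := by
  obtain ⟨C, hC, HC⟩ := sum_adm_charLog_sub_vonMangoldt_le
  obtain ⟨K₂, hK₂, HK⟩ := MatomakiMerikoski2023_lemma22_sharp
  refine ⟨C * Real.exp 1 * K₂, by positivity, ?_⟩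
  intro q _ χ hprim hquad η hη hL v hv X h hh hz2 hzX huz hB1
  set z : ℝ := (q : ℝ) ^ v with hz_def
  have hsq : χ ^ 2 = 1 := MulChar.isQuadratic_iff_sq_eq_one.mp hquad
  have hz1 : 1 < z := by linarith
  have hz0 : 0 < z := by linarith
  have hX2 : 2 ≤ X := by
    have : (2 : ℝ) < X := lt_of_le_of_lt hz2 hzX
    exact_mod_cast this.le
  have hX0 : (0 : ℝ) < X := by exact_mod_cast (show 0 < X by omega)
  set L : ℝ := Real.log X / Real.log z with hL_def
  set B : ℝ := 1 / (v ^ 2 * η ^ (v / 2)) + v / η * L + 1 / z * L ^ 2 with hB_def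
  have hη0 : 0 < η := by linarith
  have hlogz : 0 < Real.log z := Real.log_pos hz1
  have hL0 : 0 ≤ L := div_nonneg (Real.log_nonneg (by exact_mod_cast (show 1 ≤ X by omega))) hlogz.le
  have hB0 : 0 ≤ B := by rw [hB_def]; positivity
  have hφh : (0 : ℝ) < Nat.totient h := by exact_mod_cast Nat.totient_pos.mpr (by omega)
  -- Step 1: the pair-sieve bound
  have h1 := HC q χ hquad X h q z hX2 hh hz2
  -- Step 2: the weighted rough sum is at most `e` times the plain one
  set R := (Icc ⌈z⌉₊ X).filter (fun d : ℕ => ∀ p ∈ d.primeFactors, z ≤ (p : ℝ)) with hR_def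
  have h2 : ∑ d ∈ R, oneConvChi χ d * ((d : ℝ) / Nat.totient d) / d ≤
      Real.exp 1 * ∑ d ∈ R, charDivisorSum χ d / d := by
    rw [Finset.mul_sum]
    refine Finset.sum_le_sum fun d hd => ?_
    rw [hR_def, Finset.mem_filter, Finset.mem_Icc] at hd
    obtain ⟨⟨hd1, hdX⟩, hdr⟩ := hd
    have hd0 : d ≠ 0 := by
      have : 1 ≤ ⌈z⌉₊ := Nat.one_le_iff_ne_zero.mpr (by rw [Ne, Nat.ceil_eq_zero]; linarith)
      omega
    have hl0 : 0 ≤ oneConvChi χ d := oneConvChi_nonneg χ hquad d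
    have hφ := self_div_totient_le_exp_one_of_rough hd0 hdX hz1 hdr huz
    have hd0' : (0 : ℝ) < d := by exact_mod_cast Nat.pos_of_ne_zero hd0
    rw [oneConvChi_eq_charDivisorSum χ hsq d] at hl0 ⊢
    calc charDivisorSum χ d * ((d : ℝ) / Nat.totient d) / d
        ≤ charDivisorSum χ d * Real.exp 1 / d :=
          div_le_div_of_nonneg_right (mul_le_mul_of_nonneg_left hφ hl0) hd0'.le
      _ = Real.exp 1 * (charDivisorSum χ d / d) := by ring
  -- Step 3: Lemma 2.2 (sharp form), on the larger set `rough ↦ coprime to P(z)`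
  have h3 : ∑ d ∈ R, charDivisorSum χ d / d ≤
      ∑ d ∈ (Icc ⌈z⌉₊ ⌊(X : ℝ)⌋₊).filter (fun d : ℕ => d.Coprime (primesProdBelow z)),
        charDivisorSum χ d / d := by
    refine Finset.sum_le_sum_of_subset_of_nonneg ?_ fun d _ _ =>
      div_nonneg (charDivisorSum_nonneg χ hsq d) (Nat.cast_nonneg d)
    intro d hd
    rw [hR_def, Finset.mem_filter, Finset.mem_Icc] at hd
    obtain ⟨⟨hd1, hdX⟩, hdr⟩ := hd
    have hd0 : d ≠ 0 := by
      have : 1 ≤ ⌈z⌉₊ := Nat.one_le_iff_ne_zero.mpr (by rw [Ne, Nat.ceil_eq_zero]; linarith)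
      omega
    rw [Finset.mem_filter, Finset.mem_Icc, Nat.floor_natCast]
    exact ⟨⟨hd1, hdX⟩, coprime_primesProdBelow_of_rough hd0 hdr⟩
  have h4 := HK q χ hprim hquad η hη hL v hv (X : ℝ) hzX hB1
  -- assembly
  have hpre : 0 ≤ C * ((h : ℝ) / Nat.totient h) * X * (Real.log X / Real.log z ^ 2) := by positivity
  calc _ ≤ C * ((h : ℝ) / Nat.totient h) * X * (Real.log X / Real.log z ^ 2) *
          ∑ d ∈ R, oneConvChi χ d * ((d : ℝ) / Nat.totient d) / d := h1
    _ ≤ C * ((h : ℝ) / Nat.totient h) * X * (Real.log X / Real.log z ^ 2) *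
          (Real.exp 1 * (K₂ * B)) := by
        refine mul_le_mul_of_nonneg_left (h2.trans ?_) hpre
        exact mul_le_mul_of_nonneg_left (h3.trans h4) (Real.exp_pos 1).le
    _ = C * Real.exp 1 * K₂ * ((h : ℝ) / Nat.totient h) * X * (Real.log X / Real.log z ^ 2) * B := by
        ring

end Literature.Barriers.Parity.MatomakiMerikoski
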